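import Summits.AnomalousDissipation.AnomalousDissipation.Theses.EulerLimit
import Summits.AnomalousDissipation.AnomalousDissipation.Cruxes.EulerlimitThesisV2.Lines.tight
import Literature.Analysis.FunctionSpaces.BesovDifference
import Literature.Analysis.FunctionSpaces.TorusSpaceTimeL3Cauchy
import Literature.Analysis.FunctionSpaces.TorusMollifiedFieldFourierBounds
import Literature.Analysis.FluidPDE.ClassicalNSFourierModes

/-!
# Stub-ideation k2 (home family RESHAPE) — `stub_loudTightFamily` of line `tight`
(crux `EulerLimit.EulerlimitThesisV2`, stmt-AnomalousDissipation-0511)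

Elaboration sanity file for `STUB-IDEAS-stub_loudTightFamily-2.md`: the stub's type verbatim
(`LoudTightFamily`, checked `Iff.rfl` against `Tight.Statement.stub_loudTightFamily` at the end),
three RESHAPED hearts (`LoudSpaceTightFamily`, `LoudTwoRangeFamily`, `SteadyL3Realisation`) and
the typed helper lemmas gluing each back to the stub BY NAME (final `example`s).
Every `sorry` is a helper lemma for a prover; nothing here is registered; the skeleton is untouched.
-/

set_option linter.dupNamespace false
set_option linter.unusedVariables false

noncomputable section

open Filter Set MeasureTheory Function UnitAddTorus
open scoped ENNReal NNReal Convolution Topology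

namespace Summit.AnomalousDissipation.AnomalousDissipation.Cruxes.EulerlimitThesisV2.Tight.Ideas2

open Literature.Analysis.FunctionSpaces Literature.Analysis.FunctionSpaces.Torus

/-- The physical flat unit torus `𝕋³` (local notation). -/
local notation "𝕋³" => UnitAddTorus (Fin 3)
/-- Velocity values (local notation). -/
local notation "E³" => EuclideanSpace ℝ (Fin 3)

/-! ## §0 The stub, by value (verbatim copy of the registered signature; defeq to
`Tight.Statement.stub_loudTightFamily`) -/

/-- `H` = the registered stub `stub_loudTightFamily`, verbatim. -/
def LoudTightFamily : Prop :=
  ∃ f : 𝕋³ → E³, Torus.IsSmooth f ∧ Torus.IsDivFree f ∧ Torus.HasZeroMean f ∧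
    ∃ (τ c E M : ℝ), 0 < τ ∧ 0 < c ∧
      ∃ (ν : ℕ → ℝ) (us : ℕ → ℝ → 𝕋³ → E³) (ps : ℕ → ℝ → 𝕋³ → ℝ),
        (∀ j, 0 < ν j) ∧ Filter.Tendsto ν Filter.atTop (nhds 0) ∧
        (∀ j, IsClassicalNSSolutionOn Set.univ (ν j) (fun _ => f) (us j) (ps j) ∧
          Function.Periodic (us j) τ) ∧
        (∀ j t, ∫ x, ‖us j t x‖ ^ 2 ≤ E) ∧
        (∀ j, ∫⁻ t in Set.Ioo 0 τ, ∫⁻ x, ‖us j t x‖ₑ ^ 3 ≤ ENNReal.ofReal M) ∧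
        (∀ j, c ≤ ∫ t in (0 : ℝ)..τ, MeasureTheory.integral MeasureTheory.volume
            (fun x => inner ℝ (f x) (us j t x))) ∧
        (∀ ε : ℝ, 0 < ε → ∃ δ : ℝ, 0 < δ ∧ ∀ (j : ℕ) (s : ℝ) (h : 𝕋³), |s| ≤ δ → ‖h‖ ≤ δ →
            ∫⁻ t in Set.Ioo 0 τ, ∫⁻ x, ‖us j (t + s) (x + h) - us j t x‖ₑ ^ 3 ≤ ENNReal.ofReal ε)

/-! ## §A PLAN A — split the modulus: SPACE tightness is the heart, TIME tightness is slaved to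
the Navier–Stokes equation (Fourier-mode Lipschitz bounds + mollifier split). -/

/-- **Reshaped heart `H_A`**: the stub with the space–time modulus replaced by the purely SPATIAL
slab modulus `sup_j ∫₀^τ‖u_j(t,·+h) − u_j(t,·)‖³_{L³} → 0` as `h → 0` (uniform vanishing of the
absolute third-order structure function; K41 currency `p = 3`). -/
def LoudSpaceTightFamily : Prop :=
  ∃ f : 𝕋³ → E³, Torus.IsSmooth f ∧ Torus.IsDivFree f ∧ Torus.HasZeroMean f ∧
    ∃ (τ c E M : ℝ), 0 < τ ∧ 0 < c ∧
      ∃ (ν : ℕ → ℝ) (us : ℕ → ℝ → 𝕋³ → E³) (ps : ℕ → ℝ → 𝕋³ → ℝ),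
        (∀ j, 0 < ν j) ∧ Filter.Tendsto ν Filter.atTop (nhds 0) ∧
        (∀ j, IsClassicalNSSolutionOn Set.univ (ν j) (fun _ => f) (us j) (ps j) ∧
          Function.Periodic (us j) τ) ∧
        (∀ j t, ∫ x, ‖us j t x‖ ^ 2 ≤ E) ∧
        (∀ j, ∫⁻ t in Set.Ioo 0 τ, ∫⁻ x, ‖us j t x‖ₑ ^ 3 ≤ ENNReal.ofReal M) ∧
        (∀ j, c ≤ ∫ t in (0 : ℝ)..τ, MeasureTheory.integral MeasureTheory.volume
            (fun x => inner ℝ (f x) (us j t x))) ∧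
        (∀ ε : ℝ, 0 < ε → ∃ δ : ℝ, 0 < δ ∧ ∀ (j : ℕ) (h : 𝕋³), ‖h‖ ≤ δ →
            ∫⁻ t in Set.Ioo 0 τ, ∫⁻ x, ‖us j t (x + h) - us j t x‖ₑ ^ 3 ≤ ENNReal.ofReal ε)

/-- **A0 (S; in-tree pieces `Literature.Analysis.FluidPDE.setLIntegral_Ioo_add_right`,
`lintegral_Ioc_eq_of_periodic`, `Ioo_ae_eq_Ioc`).** Period windows of a `τ`-periodic
`ℝ≥0∞`-valued function may be shifted. -/
theorem setLIntegral_Ioo_comp_add_of_periodic {g : ℝ → ℝ≥0∞} {τ : ℝ} (hτ : 0 < τ)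
    (hg : Function.Periodic g τ) (s : ℝ) :
    ∫⁻ t in Ioo 0 τ, g (t + s) = ∫⁻ t in Ioo 0 τ, g t := by
  sorry

/-- **A1 (S; corollary of the FORCED tree theorem
`Torus.IsClassicalNSSolutionOn.norm_mFourierCoeff_sub_le`, RRS2016 Thm 4.4 Step 3).**
Uniform-in-time energy `≤ E` and a steady force make every Fourier mode of a global classical
solution Lipschitz in time, with a constant depending only on `(k, E, |ν|, ∫‖f‖)`
(`∫‖u‖ ≤ (∫‖u‖²)^{1/2}` on the probability space `𝕋³`, `Fintype.card (Fin 3) = 3`). -/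
theorem modeLipschitz {ν E : ℝ} {f : 𝕋³ → E³} {u : ℝ → 𝕋³ → E³} {p : ℝ → 𝕋³ → ℝ}
    (h : IsClassicalNSSolutionOn Set.univ ν (fun _ => f) u p)
    (hE : ∀ t, ∫ x, ‖u t x‖ ^ 2 ≤ E) (k : Fin 3 → ℤ) {s t : ℝ} (hst : s ≤ t) :
    ‖mFourierCoeff (EuclideanSpace.complexify ∘ u t) k -
        mFourierCoeff (EuclideanSpace.complexify ∘ u s) k‖ ≤
      (t - s) * (3 * (2 * Real.pi * Real.sqrt (freqNormSq k)) * E +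
        |ν| * (4 * Real.pi ^ 2 * freqNormSq k) * Real.sqrt E + ∫ x, ‖f x‖) := by
  sorry

/-- **A2 (M; slab version of the tree's `Torus.eLpNorm_kernel_convolution_sub_self_le`, CET (6)).**
If the spatial SLAB modulus at scale `ε` is `≤ A`, so is the slab mollification error:
`(ρ_ε ⋆ w(t))(x) − w(t,x) = ∫ ρ_ε(y) (w(t,x−y) − w(t,x)) dy` (`kernel_convolution_sub_self_apply`),
Jensen/Hölder pointwise with the probability density `ρ_ε ≥ 0` (`integral_kernel`), Tonelli to
move `∫ dy` outside `∫ dt ∫ dx`, the hypothesis for `‖y‖ ≤ ε` (`support_kernel_subset`). -/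
theorem slab_mollify_sub_self_le {τ : ℝ} {w : ℝ → 𝕋³ → E³}
    (hw : IsSmoothSpaceTimeOn Set.univ w) {ε : ℝ} (hε : 0 < ε) (hε' : ε ≤ 1 / 4) {A : ℝ≥0∞}
    (hA : ∀ h : 𝕋³, ‖h‖ ≤ ε → ∫⁻ t in Ioo 0 τ, ∫⁻ x, ‖w t (x + h) - w t x‖ₑ ^ 3 ≤ A) :
    ∫⁻ t in Ioo 0 τ, ∫⁻ x, ‖(kernel ε ⋆ w t) x - w t x‖ₑ ^ 3 ≤ A := by
  sorry

/-- **A3 (M–L; the load-bearing glue lemma: TIME modulus from SPACE modulus + the equation;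
clone of the tree's `Torus.exists_forall_lintegral_sub_pow_three_le_of_modes` with the pair
`(w n, w m)` replaced by `(u_j(· + s), u_j)`).**  Split
`u(·+s) − u = [u(·+s) − ρ_ε⋆u(·+s)] + ρ_ε⋆[u(·+s) − u] + [ρ_ε⋆u − u]`: the outer terms are
`≤ A(ε)^{1/3}` in `L³(slab)` by A2 (+ A0 for the shifted window); the middle term is bounded
POINTWISE by `∑_{|k|≤K} ‖û(t+s,k) − û(t,k)‖ + ‖u(t+s) − u(t)‖_{L¹} τ_K(ε)`
(`Torus.norm_kernel_convolution_apply_le`) `≤ |s|·L(K,E,νmax,f) + 2√E·τ_K(ε)` (A1,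
`Torus.tendsto_tsum_compl_norm_mFourierCoeff_kernel`); choose `ε`, then `K`, then `δ`. -/
theorem timeModulus_of_spaceModulus {f : 𝕋³ → E³} {τ E νmax : ℝ} (hτ : 0 < τ)
    {ν : ℕ → ℝ} {us : ℕ → ℝ → 𝕋³ → E³} {ps : ℕ → ℝ → 𝕋³ → ℝ}
    (hν : ∀ j, |ν j| ≤ νmax)
    (hcl : ∀ j, IsClassicalNSSolutionOn Set.univ (ν j) (fun _ => f) (us j) (ps j))
    (hper : ∀ j, Function.Periodic (us j) τ)
    (hE : ∀ j t, ∫ x, ‖us j t x‖ ^ 2 ≤ E)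
    (hspace : ∀ ε : ℝ, 0 < ε → ∃ δ : ℝ, 0 < δ ∧ ∀ (j : ℕ) (h : 𝕋³), ‖h‖ ≤ δ →
      ∫⁻ t in Ioo 0 τ, ∫⁻ x, ‖us j t (x + h) - us j t x‖ₑ ^ 3 ≤ ENNReal.ofReal ε)
    {ε : ℝ} (hε : 0 < ε) :
    ∃ δ : ℝ, 0 < δ ∧ ∀ (j : ℕ) (s : ℝ), |s| ≤ δ →
      ∫⁻ t in Ioo 0 τ, ∫⁻ x, ‖us j (t + s) x - us j t x‖ₑ ^ 3 ≤ ENNReal.ofReal ε := by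
  sorry

/-- **A4 (M; assembly `H_A → H`).**  `u(t+s,x+h) − u(t,x) = [u(t+s,x+h) − u(t+s,x)] + [u(t+s,x) − u(t,x)]`:
the first bracket has slab integral equal (A0, periodicity) to the spatial modulus, the second is
A3 (`νmax` from `ν_j → 0`); triangle inequality in `L³(slab)` with the cube-root bookkeeping of
`TorusSpaceTimeL3Cauchy` (`lintegral_prod_norm_pow_le`-style, each piece `≤ ε/8`). -/
theorem loudTight_of_loudSpaceTight : LoudSpaceTightFamily → LoudTightFamily := by
  sorry

/-- **E1 (S–M, OPTIONAL pruning of `H_A`): the energy ceiling is not an independent datum.**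
For a `τ`-periodic classical solution, `sup_t ∫‖u(t)‖² ≤ τ^{-2/3} M^{2/3} + 2 ‖f‖_∞ τ^{2/3} M^{1/3}`
(mean-value in time of the energy over a period + Hölder on the slab, then the energy balance
`Torus.IsClassicalNSSolutionOn.energy_balance_holds` forward over at most one period, dropping
`−ν‖∇u‖²`). Lets a prover of `H_A` skip the energy clause. -/
theorem energy_le_of_slabMass {ν τ M B : ℝ} {f : 𝕋³ → E³} {u : ℝ → 𝕋³ → E³} {p : ℝ → 𝕋³ → ℝ}
    (hτ : 0 < τ) (hν : 0 ≤ ν) (h : IsClassicalNSSolutionOn Set.univ ν (fun _ => f) u p)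
    (hper : Function.Periodic u τ) (hB : ∀ x, ‖f x‖ ≤ B) (hM : 0 ≤ M)
    (hmass : ∫⁻ t in Ioo 0 τ, ∫⁻ x, ‖u t x‖ₑ ^ 3 ≤ ENNReal.ofReal M) (t : ℝ) :
    ∫ x, ‖u t x‖ ^ 2 ≤ τ ^ (-(2 : ℝ) / 3) * M ^ ((2 : ℝ) / 3) + 2 * B * τ ^ ((2 : ℝ) / 3) * M ^ ((1 : ℝ) / 3) := by
  sorry

/-! ## §B PLAN B — two-range split (Drivas–Nguyen 2019 Lemma 1 on `𝕋³`): below the dissipation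
scale the FORCED period balance `ν∫₀^τ‖∇u‖² = ∫₀^τ∫⟪f,u⟫ ≤ τ‖f‖₂√E` gives the `L²` modulus for
free; only the INERTIAL-RANGE second-order structure-function bound is physics; `L²`-tightness is
lifted to `L³` by interpolation against a uniform `L⁴(slab)` (flatness) bound. -/

/-- **Reshaped heart `H_B`**: loud periodic classical family + uniform `L⁴((0,τ)×𝕋³)` bound +
`S₂(h) ≤ C‖h‖^ζ` in the inertial range `ν_j ≤ ‖h‖^{2−ζ}` only (`ζ ∈ (0,2)`: K41 `ζ₂ = 2/3`). -/
def LoudTwoRangeFamily : Prop :=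
  ∃ f : 𝕋³ → E³, Torus.IsSmooth f ∧ Torus.IsDivFree f ∧ Torus.HasZeroMean f ∧
    ∃ (τ c E M₄ C ζ : ℝ), 0 < τ ∧ 0 < c ∧ 0 < ζ ∧ ζ < 2 ∧
      ∃ (ν : ℕ → ℝ) (us : ℕ → ℝ → 𝕋³ → E³) (ps : ℕ → ℝ → 𝕋³ → ℝ),
        (∀ j, 0 < ν j) ∧ Filter.Tendsto ν Filter.atTop (nhds 0) ∧
        (∀ j, IsClassicalNSSolutionOn Set.univ (ν j) (fun _ => f) (us j) (ps j) ∧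
          Function.Periodic (us j) τ) ∧
        (∀ j t, ∫ x, ‖us j t x‖ ^ 2 ≤ E) ∧
        (∀ j, ∫⁻ t in Set.Ioo 0 τ, ∫⁻ x, ‖us j t x‖ₑ ^ 4 ≤ ENNReal.ofReal M₄) ∧
        (∀ j, c ≤ ∫ t in (0 : ℝ)..τ, MeasureTheory.integral MeasureTheory.volume
            (fun x => inner ℝ (f x) (us j t x))) ∧
        (∀ (j : ℕ) (h : 𝕋³), ν j ≤ ‖h‖ ^ (2 - ζ) →
            ∫⁻ t in Set.Ioo 0 τ, ∫⁻ x, ‖us j t (x + h) - us j t x‖ₑ ^ 2 ≤ ENNReal.ofReal (C * ‖h‖ ^ ζ))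

/-- **B1 (S–M): dissipation-range `L²` modulus of a smooth slice.**
`‖w(·+h) − w‖²_{L²} ≤ 3 ‖h‖² ‖∇w‖²_{L²}` on `𝕋³` (sup-norm on `𝕋³ = (ℝ/ℤ)³`, whence `card (Fin 3)`;
mean-value along `θ ↦ x + θh` + Jensen + translation invariance, or Parseval with
`|e^{2πik·h} − 1| ≤ 2π|k|√3‖h‖` and `Torus.gradNormSq_eq_toReal_eGradNormSq_holds`). -/
theorem lintegral_translate_sub_sq_le_gradNormSq {w : 𝕋³ → E³} (hw : Torus.IsSmooth w) (h : 𝕋³) :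
    ∫⁻ x, ‖w (x + h) - w x‖ₑ ^ 2 ≤ ENNReal.ofReal (3 * ‖h‖ ^ 2 * gradNormSq w) := by
  sorry

/-- **B2 (S; = conjunct (1) of route item `EulerLimit.PeriodAverageBalanceV2`, stmt-0513, whose two
fact-hypotheses are the PROVED `energy_balance_holds`, `gradNormSq_eq_toReal_eGradNormSq_holds`) +
Cauchy–Schwarz:** the period dissipation of a `τ`-periodic classical solution is paid by the input,
`ν ∫₀^τ ‖∇u‖² = ∫₀^τ ∫⟪f,u⟫ ≤ τ ‖f‖_{L²} √E`. -/
theorem period_dissipation_le {ν τ E : ℝ} {f : 𝕋³ → E³} {u : ℝ → 𝕋³ → E³} {p : ℝ → 𝕋³ → ℝ}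
    (hτ : 0 < τ) (hf : Torus.IsSmooth f) (h : IsClassicalNSSolutionOn Set.univ ν (fun _ => f) u p)
    (hper : Function.Periodic u τ) (hE : ∀ t, ∫ x, ‖u t x‖ ^ 2 ≤ E) :
    ν * ∫ t in (0 : ℝ)..τ, gradNormSq (u t) ≤ τ * Real.sqrt (∫ x, ‖f x‖ ^ 2) * Real.sqrt E := by
  sorry

/-- **B3 (S): Cauchy–Schwarz lift `L² × L⁴ → L³` on the slab** (`|g|³ = |g|·|g|²`,
`ENNReal.lintegral_mul_le_Lp_mul_Lq` with `p = q = 2`, twice / on the product measure). -/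
theorem slab_lintegral_pow_three_le {τ : ℝ} {g : ℝ → 𝕋³ → E³} (hg : IsSmoothSpaceTimeOn Set.univ g) :
    ∫⁻ t in Ioo 0 τ, ∫⁻ x, ‖g t x‖ₑ ^ 3 ≤
      (∫⁻ t in Ioo 0 τ, ∫⁻ x, ‖g t x‖ₑ ^ 2) ^ ((1 : ℝ) / 2) *
        (∫⁻ t in Ioo 0 τ, ∫⁻ x, ‖g t x‖ₑ ^ 4) ^ ((1 : ℝ) / 2) := by
  sorry

/-- **B4 (M; assembly `H_B → H_A`).** For every `j, h`: either `ν_j ≤ ‖h‖^{2−ζ}` (inertial: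
hypothesis) or `ν_j > ‖h‖^{2−ζ}` (dissipative: B1 + B2 give `S₂ ≤ 3‖h‖²·τ‖f‖₂√E/ν_j ≤ 3τ‖f‖₂√E·‖h‖^ζ`),
so `S₂(h) ≤ C'‖h‖^ζ` for ALL `h`; `(a−b)⁴ ≤ 8(a⁴+b⁴)` + translation invariance give the `L⁴` bound
`16 M₄` for the increment; B3 yields the spatial `L³` slab modulus `≤ (C'‖h‖^ζ)^{1/2} (16M₄)^{1/2}`;
`L³` mass from `L⁴` by Hölder on the finite slab. -/
theorem loudSpaceTight_of_loudTwoRange : LoudTwoRangeFamily → LoudSpaceTightFamily := by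
  sorry

/-! ## §C PLAN C — change the unknown: STEADY states are `τ`-periodic for every `τ`, the time
modulus is vacuous, and `∀ε∃δ∀j` is the Kolmogorov–Riesz NECESSITY side of an `L³`-convergent
sequence.  `H_C` = route SteadyWeakLimit's `SteadyWeakRealisation` (stmt-1303) with weak-`L²`
convergence upgraded to strong `L³`. -/

/-- **Reshaped heart `H_C`**: some steady smooth force drives steady classical states `u_j` of
`NS(ν_j, f)`, `ν_j → 0⁺`, converging in `L³(𝕋³)` to a field `v` of positive input `∫⟪f,v⟫ > 0`. -/
def SteadyL3Realisation : Prop :=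
  ∃ f : 𝕋³ → E³, Torus.IsSmooth f ∧ Torus.IsDivFree f ∧ Torus.HasZeroMean f ∧
    ∃ (ν : ℕ → ℝ) (u : ℕ → 𝕋³ → E³) (p : ℕ → 𝕋³ → ℝ) (v : 𝕋³ → E³),
      (∀ j, 0 < ν j) ∧ Filter.Tendsto ν Filter.atTop (nhds 0) ∧
      (∀ j, IsClassicalNSSolutionOn Set.univ (ν j) (fun _ => f) (fun _ => u j) (fun _ => p j)) ∧
      MemLp v 3 volume ∧
      Filter.Tendsto (fun j => ∫⁻ x, ‖u j x - v x‖ₑ ^ 3) Filter.atTop (nhds 0) ∧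
      0 < ∫ x, inner ℝ (f x) (v x)

/-- **C1 (M; Kolmogorov–Riesz necessity for a convergent sequence on the compact group `𝕋³`).**
An `L³`-convergent sequence of smooth fields is `L³`-equicontinuous under translations
uniformly: `‖τ_h u_j − u_j‖₃ ≤ 2‖u_j − v‖₃ + ‖τ_h v − v‖₃`, continuity of translation in `L³`
for the single `v` (IN TREE: `Literature.Analysis.FluidPDE.Torus.tendsto_lintegral_comp_add_sub`,
`Literature.Analysis.FunctionSpaces.continuous_eLpNorm_comp_add_sub`), and the finitely many smooth
`u_j`, `j < N`, by the same lemma (or uniform continuity). -/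
theorem uniformModulus_of_tendsto_L3 {u : ℕ → 𝕋³ → E³} {v : 𝕋³ → E³}
    (hu : ∀ j, Torus.IsSmooth (u j)) (hv : MemLp v 3 volume)
    (hlim : Filter.Tendsto (fun j => ∫⁻ x, ‖u j x - v x‖ₑ ^ 3) Filter.atTop (nhds 0))
    {ε : ℝ} (hε : 0 < ε) :
    ∃ δ : ℝ, 0 < δ ∧ ∀ (j : ℕ) (h : 𝕋³), ‖h‖ ≤ δ →
      ∫⁻ x, ‖u j (x + h) - u j x‖ₑ ^ 3 ≤ ENNReal.ofReal ε := by
  sorry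

/-- **C2 (S–M; input convergence and eventual floor).** `|∫⟪f,u_j⟫ − ∫⟪f,v⟫| ≤ ‖f‖_∞ ‖u_j − v‖_{L¹}
≤ ‖f‖_∞ ‖u_j − v‖_{L³}` on the probability space, hence eventually `∫⟪f,u_j⟫ ≥ ½∫⟪f,v⟫`
(the step `GlueSteadyZerothLaw` of route SteadyWeakLimit performed with weak convergence). -/
theorem eventually_input_ge_half {f : 𝕋³ → E³} (hf : Torus.IsSmooth f) {u : ℕ → 𝕋³ → E³}
    {v : 𝕋³ → E³} (hu : ∀ j, Torus.IsSmooth (u j)) (hv : MemLp v 3 volume)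
    (hlim : Filter.Tendsto (fun j => ∫⁻ x, ‖u j x - v x‖ₑ ^ 3) Filter.atTop (nhds 0)) :
    ∀ᶠ j in Filter.atTop, (∫ x, inner ℝ (f x) (v x)) / 2 ≤ ∫ x, inner ℝ (f x) (u j x) := by
  sorry

/-- **C3 (M; assembly `H_C → H`).** Reindex past the floor index `N` of C2 (`ν (j+N) → 0` still);
`us j := fun _ => u (j+N)` is `τ := 1`-periodic and classical on `univ`; slab integrals of
time-constant integrands are `τ ×` slice integrals (`setLIntegral_const`, `Real.volume_Ioo`,
`intervalIntegral.integral_const`); energy and `L³` mass from the convergent (hence bounded) `L³`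
norms; the space–time modulus has NO time part and its space part is C1. -/
theorem loudTight_of_steadyL3 : SteadyL3Realisation → LoudTightFamily := by
  sorry

/-- Defeq check: the by-value copy IS the registered stub's statement. -/
example : LoudTightFamily ↔
    _root_.Summit.AnomalousDissipation.AnomalousDissipation.Cruxes.EulerlimitThesisV2.Tight.Statement.stub_loudTightFamily :=
  Iff.rfl

/-- Hence each plan's assembly concludes the registered stub BY NAME. -/
example (hA : LoudSpaceTightFamily) :
    _root_.Summit.AnomalousDissipation.AnomalousDissipation.Cruxes.EulerlimitThesisV2.Tight.Statement.stub_loudTightFamily :=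
  loudTight_of_loudSpaceTight hA

example (hB : LoudTwoRangeFamily) :
    _root_.Summit.AnomalousDissipation.AnomalousDissipation.Cruxes.EulerlimitThesisV2.Tight.Statement.stub_loudTightFamily :=
  loudTight_of_loudSpaceTight (loudSpaceTight_of_loudTwoRange hB)

example (hC : SteadyL3Realisation) :
    _root_.Summit.AnomalousDissipation.AnomalousDissipation.Cruxes.EulerlimitThesisV2.Tight.Statement.stub_loudTightFamily :=
  loudTight_of_steadyL3 hC

end Summit.AnomalousDissipation.AnomalousDissipation.Cruxes.EulerlimitThesisV2.Tight.Ideas2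

end
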